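/-
COR-CM (cell pub-hodgecm2, stage 2 of the Hodge ladder) — count-neutral KERNEL COMBINATORICS «order 16: the quaternion doublings `Q₈ × ℤ/2` and
`Q₈ ∘ ℤ/4` (Pauli)», part VII: the ENGINE, II — a valid plan discharges seat b23 gen 46ʼs split index-two CHECKLIST over the quaternion core
(seat prover-pub-hodgecm2-b23-g54-0, binder prover b23, gen 54; claim HOME/INBOX.md l.25095).  Theorems only, on parts I–VI, seat b23 gen 46ʼs
`IndexTwoDescent.hodgeSpan_le_of_rep_checklist`, gen 47ʼs `Spectator.descends_of_devs` and gen 50ʼs `IndexTwoCyclic.isLeast_card_gfaces_generate_fibreTwo_of_quaternion`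
BY NAME; no `decide` beyond closed identities in `ZMod 2`/`Fin 4`, no certificate, no named fact, no `sorry`.  `Interfaces.lean` (C1), every E term, B01,
`Transposition/*`, `PortJoin/*`, `D2Bridge/*` untouched.
HONEST FRAMING: `HC_CM` is NOT proved, here or anywhere in the tree; nothing here is a period, a count of record or a headline.
T5: n/a-class (hypothesis binders = the fields of `QuaternionDoubling.Datum` and `Plan.Valid`); checker: self.
-/
import Summits.HodgeConjecture.CorCM.Census.QuaternionDoublingEngine
import Summits.HodgeConjecture.CorCM.Census.IndexTwoCyclicQuaternion

/-!
# The quaternion doublings, VII: the engine, II — a valid plan generates the Hodge lattice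

For a datum `D : Datum G c τ` and a plan `P` with `P.Valid τ`: the family module `N = ℤ⟨pairs⟩ + ℤ[G]·famFin` satisfies the hypotheses of the
representative form of the split index-two checklist over the core `H = ⟨i, j⟩ ≅ Q₈` with the involution `x` outside:
* §1 the obligations at the representatives `rep b` (part VI): **two-cycle faces** at diagonal representatives and **square elements** at
  representatives of distance `2` are available face sums of the plan, hence in `N` (`twoCycle_mem`, `square_mem`); **descending faces** come from
  the planʼs descending data, with the distance drops of `Spectator.descends_of_devs` (`desc_mem`); **lifts** of ANY face family of `H` — in
  particular of the generating family of `φ₂(H)` faces provided by the quaternion law (seat b23 gen 50) — are base changes along `H`-words of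
  coordinate faces at diagonal representatives, hence in `N` (`lift_mem`);
* §2 **GENERATION** (`hodgeSpan_le_N`): `hodgeSpan (G, c) ≤ N`, with `|famFin| ≤ |fam|` faces and `|reps| ≤ β(G, c)` (part VI).
All [folklore] bookkeeping over [Pohlmann1968, Thm 1].

## References
* [Pohlmann1968] H. Pohlmann, Algebraic cycles on abelian varieties of complex multiplication type, Ann. of Math. 88 (1968), Thm 1.
-/

namespace Summit.HodgeConjecture.CorCM.Census.QuaternionDoubling

open Finset
open Summit.HodgeConjecture.CorCM.Prior.AllgGroup.RfwfAllgGroup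
open Summit.HodgeConjecture.CorCM.Census.BlockParity
open Summit.HodgeConjecture.CorCM.Census.Coinvariant
open Summit.HodgeConjecture.CorCM.Census.ComplementFaces
open Summit.HodgeConjecture.CorCM.Census.IndexTwoDescent

noncomputable section

variable {G : Type*} [Group G] [Fintype G] [DecidableEq G] {c : G} {τ : ZMod 2} (D : Datum G c τ) (P : Plan)
variable [DecidablePred (· ∈ D.H)]

/-! ## §1 The obligations at the representatives -/

omit [Fintype G] [DecidableEq G] [DecidablePred (· ∈ D.H)] in
/-- An element of the core, written as a word, IS that word (as an element of `H`). [folklore] -/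
theorem subtype_eq_word {t : D.H} {e : ZMod 2} {u : Fin 4} (h : (t : G) = word D e (hp u)) :
    t = ⟨word D e (hp u), word_hp_mem_H D e u⟩ := Subtype.ext h

/-- **Two-cycle faces at diagonal representatives lie in `N`.** [folklore] -/
theorem twoCycle_mem (hV : P.Valid τ = true) (b : Block c)
    (hdiag : res₁ D.c_mem_H (Subgroup.mem_center_iff.mp D.c_mem_center) D.x (rep D P b) = res₀ D.c_mem_H (rep D P b)) (t : D.H) :
    gface c D.c_mul_c (rep D P b) (t : G) (D.x * (t : G)) ∈ N D P := by
  obtain ⟨r, hr, hrep⟩ := rep_eq D P hV b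
  have h0 : Dst τ (P.rep r) = 0 := by
    rw [← wt_typeOf D (P.rep r), ← hrep, hdiag, ComplementFaces.wt_self]
  obtain ⟨e, u, hte⟩ := exists_word_hp_of_mem_H D t.2
  rw [hrep, hte, x_mul_word_hp, gface_word_word, ← absSrc_singleton]
  exact absSrc_mem_of_avail D P hV ((Plan.oblig_diag hV hr h0).1 u)

/-- A list of length two. [folklore] -/
private theorem mem_pair_of_length_two {l : List (Fin 4)} (hl : l.length = 2) {u : Fin 4} (hu : u ∈ l) :
    (u = l.getD 0 0 ∨ u = l.getD 1 0) ∧ l.getD 0 0 ∈ l ∧ l.getD 1 0 ∈ l := by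
  obtain ⟨a, b, rfl⟩ := List.length_eq_two.mp hl
  simp only [List.mem_cons, List.not_mem_nil, or_false] at hu
  simpa using hu

omit [DecidablePred (· ∈ D.H)] in
/-- The abstract value of a square element. [folklore] -/
theorem absSrc_squareSrc (ρ : Lab) (u u' : Fin 4) :
    absSrc D (Plan.squareSrc ρ u u') = absF D (ρ, hp u, xp u') - absF D (ρ, hp u', xp u) := by
  simp only [Plan.squareSrc, absSrc, List.map_cons, List.map_nil, List.sum_cons, List.sum_nil, one_smul, neg_smul, add_zero,
    sub_eq_add_neg]

/-- **Square elements at representatives of distance `2` lie in `N`.** [folklore] -/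
theorem square_mem (hV : P.Valid τ = true) (b : Block c)
    (h2 : wt (⟨c, D.c_mem_H⟩ : D.H) (res₁ D.c_mem_H (Subgroup.mem_center_iff.mp D.c_mem_center) D.x (rep D P b)) (res₀ D.c_mem_H (rep D P b)) = 2) (k l : D.H)
    (hk1 : k ∈ (res₁ D.c_mem_H (Subgroup.mem_center_iff.mp D.c_mem_center) D.x (rep D P b)).1) (hk0 : k ∉ (res₀ D.c_mem_H (rep D P b)).1)
    (hl1 : l ∈ (res₁ D.c_mem_H (Subgroup.mem_center_iff.mp D.c_mem_center) D.x (rep D P b)).1) (hl0 : l ∉ (res₀ D.c_mem_H (rep D P b)).1) (hkl : k ≠ l) :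
    gface c D.c_mul_c (rep D P b) (k : G) (D.x * (l : G)) - gface c D.c_mul_c (rep D P b) (l : G) (D.x * (k : G)) ∈ N D P := by
  obtain ⟨r, hr, hrep⟩ := rep_eq D P hV b
  set ρ := P.rep r with hρ
  have hD2 : Dst τ ρ = 2 := by rw [← wt_typeOf D ρ, ← hrep]; exact h2
  obtain ⟨e, u, hke⟩ := exists_word_hp_of_mem_H D k.2
  obtain ⟨e', u', hle⟩ := exists_word_hp_of_mem_H D l.2
  have hk := subtype_eq_word D hke
  have hl := subtype_eq_word D hle
  rw [hrep] at hk1 hk0 hl1 hl0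
  rw [hk] at hk1 hk0
  rw [hl] at hl1 hl0
  obtain ⟨hu, heu⟩ := (word_dev_iff D (typeOf D ρ) e u).mp ⟨hk1, hk0⟩
  obtain ⟨hu', heu'⟩ := (word_dev_iff D (typeOf D ρ) e' u').mp ⟨hl1, hl0⟩
  rw [ty_typeOf] at hu heu hu' heu'
  have hne : u ≠ u' := by
    rintro rfl
    apply hkl
    rw [hk, hl, heu, heu']
  -- the two mismatched places are `u`, `u'`, listed in `devList`
  have hlen : (Plan.devList τ ρ).length = 2 := by rw [Plan.length_devList, hD2]
  have hmu := mem_pair_of_length_two hlen ((Plan.mem_devList_iff ρ u).mpr hu)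
  have hmu' := mem_pair_of_length_two hlen ((Plan.mem_devList_iff ρ u').mpr hu')
  set a := (Plan.devList τ ρ).getD 0 0
  set a' := (Plan.devList τ ρ).getD 1 0
  have hsq : absSrc D (Plan.squareSrc ρ a a') ∈ N D P := absSrc_mem_of_avail D P hV (Plan.oblig_two hV hr hD2)
  have hval : absSrc D (Plan.squareSrc ρ a a') = absF D (ρ, hp a, xp a') - absF D (ρ, hp a', xp a) := absSrc_squareSrc D ρ a a'
  rw [hrep, hke, hle, x_mul_word_hp, x_mul_word_hp, gface_word_word, gface_word_word]
  have haa : a ≠ a' := by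
    intro h
    have hnd := Plan.devList_nodup (τ := τ) ρ
    obtain ⟨p, q, hpq⟩ := List.length_eq_two.mp hlen
    have ha0 : a = p := by simp [a, hpq]
    have ha1 : a' = q := by simp [a', hpq]
    rw [hpq] at hnd
    simp only [List.nodup_cons, List.mem_singleton, List.not_mem_nil, not_false_eq_true, List.nodup_nil, and_true] at hnd
    exact hnd (by rw [← ha0, ← ha1, h])
  rcases hmu.1 with rfl | rfl <;> rcases hmu'.1 with h' | h'
  · exact absurd h'.symm hne
  · rw [h', ← hval]; exact hsq
  · rw [h']
    have : absF D (ρ, hp a', xp a) - absF D (ρ, hp a, xp a') = -(absSrc D (Plan.squareSrc ρ a a')) := by rw [hval]; abel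
    rw [this]; exact Submodule.neg_mem _ hsq
  · exact absurd h'.symm hne

/-- **Descending faces at representatives of distance `≥ 2` lie in `N`, with the distance drops.** [folklore] -/
theorem desc_mem (hV : P.Valid τ = true) (b : Block c)
    (h2 : 2 ≤ wt (⟨c, D.c_mem_H⟩ : D.H) (res₁ D.c_mem_H (Subgroup.mem_center_iff.mp D.c_mem_center) D.x (rep D P b)) (res₀ D.c_mem_H (rep D P b))) :
    ∃ d d' : D.H, gface c D.c_mul_c (rep D P b) (d : G) (D.x * (d' : G)) ∈ N D P ∧
      wt (⟨c, D.c_mem_H⟩ : D.H) (res₁ D.c_mem_H (Subgroup.mem_center_iff.mp D.c_mem_center) D.x (oflipCM c D.c_mul_c (d : G) (rep D P b)))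
          (res₀ D.c_mem_H (oflipCM c D.c_mul_c (d : G) (rep D P b))) <
        wt (⟨c, D.c_mem_H⟩ : D.H) (res₁ D.c_mem_H (Subgroup.mem_center_iff.mp D.c_mem_center) D.x (rep D P b)) (res₀ D.c_mem_H (rep D P b)) ∧
      wt (⟨c, D.c_mem_H⟩ : D.H) (res₁ D.c_mem_H (Subgroup.mem_center_iff.mp D.c_mem_center) D.x (oflipCM c D.c_mul_c (D.x * (d' : G)) (rep D P b)))
          (res₀ D.c_mem_H (oflipCM c D.c_mul_c (D.x * (d' : G)) (rep D P b))) <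
        wt (⟨c, D.c_mem_H⟩ : D.H) (res₁ D.c_mem_H (Subgroup.mem_center_iff.mp D.c_mem_center) D.x (rep D P b)) (res₀ D.c_mem_H (rep D P b)) ∧
      wt (⟨c, D.c_mem_H⟩ : D.H) (res₁ D.c_mem_H (Subgroup.mem_center_iff.mp D.c_mem_center) D.x (oflipCM c D.c_mul_c (d : G) (oflipCM c D.c_mul_c (D.x * (d' : G)) (rep D P b))))
          (res₀ D.c_mem_H (oflipCM c D.c_mul_c (d : G) (oflipCM c D.c_mul_c (D.x * (d' : G)) (rep D P b)))) <
        wt (⟨c, D.c_mem_H⟩ : D.H) (res₁ D.c_mem_H (Subgroup.mem_center_iff.mp D.c_mem_center) D.x (rep D P b)) (res₀ D.c_mem_H (rep D P b)) := by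
  obtain ⟨r, hr, hrep⟩ := rep_eq D P hV b
  set ρ := P.rep r with hρ
  have hD2 : 2 ≤ Dst τ ρ := by rw [← wt_typeOf D ρ, ← hrep]; exact h2
  obtain ⟨u, u', hne, hu, hu', hfam⟩ := Plan.desc_spec hV hr hD2
  let d : D.H := ⟨word D (ρ (xp u) + twist τ u) (hp u), word_hp_mem_H D _ u⟩
  let d' : D.H := ⟨word D (ρ (xp u') + twist τ u') (hp u'), word_hp_mem_H D _ u'⟩
  have hd : d ∈ (res₁ D.c_mem_H (Subgroup.mem_center_iff.mp D.c_mem_center) D.x (rep D P b)).1 ∧ d ∉ (res₀ D.c_mem_H (rep D P b)).1 := by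
    rw [hrep]; exact (word_dev_iff D (typeOf D ρ) _ u).mpr ⟨by rw [ty_typeOf]; exact hu, by rw [ty_typeOf]⟩
  have hd' : d' ∈ (res₁ D.c_mem_H (Subgroup.mem_center_iff.mp D.c_mem_center) D.x (rep D P b)).1 ∧ d' ∉ (res₀ D.c_mem_H (rep D P b)).1 := by
    rw [hrep]; exact (word_dev_iff D (typeOf D ρ) _ u').mpr ⟨by rw [ty_typeOf]; exact hu', by rw [ty_typeOf]⟩
  have hdd : d ≠ d' := by
    intro h
    have := (word_eq_word_iff D _ _ _ _).mp (congrArg Subtype.val h)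
    exact hne (Fin.castLE_injective _ this.2)
  have hdrop := Spectator.descends_of_devs D.c_mem_H (Subgroup.mem_center_iff.mp D.c_mem_center) D.c_mul_c D.x_notMem_H (rep D P b) hd.1 hd.2 hd'.1 hd'.2 hdd
  refine ⟨d, d', ?_, by omega, by omega, by omega⟩
  show gface c D.c_mul_c (rep D P b) (word D _ (hp u)) (D.x * word D _ (hp u')) ∈ N D P
  rw [hrep, x_mul_word_hp, gface_word_word]
  exact absF_mem_N D P hfam

/-- **Lifts of faces of the core lie in `N`**: the lift `gface (glue Φ Φ) t t'` of every face `gface Φ t t'` of `(H, c)`. [folklore] -/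
theorem lift_mem (hV : P.Valid τ = true) (Φ : CMF D.H ⟨c, D.c_mem_H⟩) (t t' : D.H) (ht' : t' ∉ orb (⟨c, D.c_mem_H⟩ : D.H) t) :
    gface c D.c_mul_c (glue D.c_mem_H (Subgroup.mem_center_iff.mp D.c_mem_center) D.index_H D.x_notMem_H Φ Φ) (t : G) (t' : G) ∈ N D P := by
  set Ψ := glue D.c_mem_H (Subgroup.mem_center_iff.mp D.c_mem_center) D.index_H D.x_notMem_H Φ Φ with hΨ
  have h0 : Dst τ (ty D Ψ) = 0 := by
    rw [← wt_res_eq_Dst D Ψ, hΨ, res₀_glue, res₁_glue, ComplementFaces.wt_self]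
  obtain ⟨w, r, hr, hrt, hw8⟩ := exists_rt_eq_rep D P hV Ψ
  have hw := hw8 h0
  set W := wordG D w with hW
  have hWH : W ∈ D.H := wordG_mem_H D hw
  -- `Ψ = (typeOf ρ)·W`, so the face is the base change along `W⁻¹` of a coordinate face at the representative
  have hΨeq : Ψ = rt c W⁻¹ (typeOf D (P.rep r)) := by rw [← hrt, rt_inv_rt]
  have hface : gface c D.c_mul_c Ψ (t : G) (t' : G) =
      Finsupp.mapDomain (rt c W⁻¹) (gface c D.c_mul_c (typeOf D (P.rep r)) ((t : G) * W⁻¹) ((t' : G) * W⁻¹)) := by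
    rw [mapDomain_rt_gface, inv_inv, inv_mul_cancel_right, inv_mul_cancel_right, ← hΨeq]
  rw [hface]
  refine N_rt D P W⁻¹ ?_
  -- the two moved places are core places
  obtain ⟨e₁, u₁, h₁⟩ := exists_word_hp_of_mem_H D (D.H.mul_mem t.2 (D.H.inv_mem hWH))
  obtain ⟨e₂, u₂, h₂⟩ := exists_word_hp_of_mem_H D (D.H.mul_mem t'.2 (D.H.inv_mem hWH))
  have hne : u₁ ≠ u₂ := by
    intro h
    have hG : (t' : G) ∉ orb c (t : G) := fun hh => ht' ((coe_mem_orb_coe_iff D.c_mem_H t t').mp hh)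
    have := notMem_orb_mul_inv c W hG
    rw [h₁, h₂, word_mem_orb_word_iff] at this
    exact this (by rw [h])
  have hr0 : Dst τ (P.rep r) = 0 := by
    rw [← wt_typeOf D (P.rep r), ← hrt, wt_res_rt D.c_mem_H (Subgroup.mem_center_iff.mp D.c_mem_center) D.c_mul_c D.index_H D.x_notMem_H D.hxx, wt_res_eq_Dst, h0]
  rw [h₁, h₂, gface_word_word]
  rcases lt_or_gt_of_ne hne with hlt | hgt
  · rw [← absSrc_singleton]
    exact absSrc_mem_of_avail D P hV ((Plan.oblig_diag hV hr hr0).2 u₁ u₂ hlt)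
  · rw [absF, gface_comm, gface_word_word, ← absSrc_singleton]
    exact absSrc_mem_of_avail D P hV ((Plan.oblig_diag hV hr hr0).2 u₂ u₁ hgt)

/-! ## §2 Generation -/

/-- **A VALID PLAN GENERATES THE HODGE LATTICE**: `hodgeSpan (G, c) ≤ ℤ⟨pairs⟩ + ℤ[G]·famFin`. [folklore] -/
theorem hodgeSpan_le_N (hV : P.Valid τ = true) : hodgeSpan c D.c_mul_c ≤ N D P := by
  -- the core is a quaternion group: seat b23 gen 50ʼs law gives a generating family of `φ₂(H)` faces
  have hc2H : (⟨c, D.c_mem_H⟩ : D.H) * ⟨c, D.c_mem_H⟩ = 1 := Subtype.ext D.c_mul_c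
  have hq8 := IndexTwoCyclic.isLeast_card_gfaces_generate_fibreTwo_of_quaternion (G := D.H) (n := 2) hc2H
    ⟨D.i, D.i_mem_H⟩ ⟨D.j, D.j_mem_H⟩ D.sq_H.1 (by rw [D.orderOf_i_H]) D.index_zpowers_i_H D.j_notMem_zpowers_i_H D.sq_H.2 D.hji_H
    (le_refl 2)
  obtain ⟨S, hSf, -, hS⟩ := hq8.1
  refine hodgeSpan_le_of_rep_checklist D.c_mem_H D.c_mul_c D.c_ne_one (Subgroup.mem_center_iff.mp D.c_mem_center) D.index_H D.x_notMem_H D.hxx S hS (N D P)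
    (N_le_hodgeSpan D P hV) (fun Q y hy => N_rt D P Q hy) le_sup_left ?_ (rep D P) (blk_rep D P hV) ?_ ?_ ?_
  · -- lifts
    intro f hf
    obtain ⟨Φ, t, t', ht', rfl⟩ := hSf hf
    exact ⟨_, lift_mem D P hV Φ t t' ht', marg₀_gface_glue D.c_mem_H (Subgroup.mem_center_iff.mp D.c_mem_center) D.c_mul_c D.index_H D.x_notMem_H Φ t t',
      marg₁_gface_coe_coe D.c_mem_H (Subgroup.mem_center_iff.mp D.c_mem_center) D.c_mul_c D.x_notMem_H _ t t'⟩
  · exact fun b h2 => desc_mem D P hV b h2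
  · exact fun b hdiag t => twoCycle_mem D P hV b hdiag t
  · exact fun b h2 k l hk1 hk0 hl1 hl0 hkl => square_mem D P hV b h2 k l hk1 hk0 hl1 hl0 hkl

/-- **THE ENGINE, SUMMARY**: a valid plan yields a face family of at most `|fam|` faces generating the Hodge lattice modulo pairs, and at least
`|reps|` blocks. [folklore] -/
theorem exists_generating_family (hV : P.Valid τ = true) :
    (∃ S : Finset (CMF G c →₀ ℤ), ↑S ⊆ gfaceSet G c D.c_mul_c ∧ S.card ≤ P.fam.length ∧
      hodgeSpan c D.c_mul_c ≤ Submodule.span ℤ (pairSet c) ⊔ Submodule.span ℤ (translates c S)) ∧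
    P.reps.length ≤ Fintype.card (Block c) :=
  ⟨⟨famFin D P, famFin_subset D P hV, card_famFin_le D P, hodgeSpan_le_N D P hV⟩, reps_length_le_card_block D P hV⟩

end

end Summit.HodgeConjecture.CorCM.Census.QuaternionDoubling
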